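import Literature.ModelTheory.ExponentialFields.KhovanskiiLift
import HarnessLib

/-!
# Khovanskii's elimination step IV: the count of non-degenerate zeros

Topic `Literature/ModelTheory/ExponentialFields`, sequel to `KhovanskiiLift.lean`. At fixed real
parameters `β`, the transversal level sets `{P = δ}` and spheres `{Σ zⱼ² = R}` cut on the
regular curve `Γ_β` of the lifted stage-1 system are non-degenerate zero sets of the contact and
sphere systems of `KhovanskiiSystems.lean` at parameters `(β, δ)`, `(β, R)`
(`levelSet_subset_ndZeros_contactSys`, `sphere_subset_ndZeros_sphereSys`), so the
Rolle–Khovanskii count (`LevelCurveData.two_mul_card_le_of_zeros`) applied to `g = y e^{-s} - 1`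
gives **Khovanskii's step** (`Khovanskii.two_mul_card_le_step`; A. G. Khovanskii, *Fewnomials*
(1991), Ch. III; for A. J. Wilkie, Illinois J. Math. 33 (1989), §5):

`2 · #Z₀ ≤ 2 · #ndZeros (contactSys) (β, δ) + #ndZeros (sphereSys) (β, R)`

for every finite set `Z₀` of non-degenerate zeros of `F(β, ·)` and suitable `δ, R`. Everything is
**proved**.

## References

* A. G. Khovanskii, *Fewnomials*, Transl. Math. Monogr. 88, AMS (1991), Ch. III. [Khovanskii1991]
* A. J. Wilkie, *On the theory of the real exponential field*, Illinois J. Math. 33 (1989), §5,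
  Proposition (p. 402). [Wilkie1989]
-/

noncomputable section

open FirstOrder FirstOrder.Language FirstOrder.Language.Structure
open Literature.LinearAlgebra.Matrix

namespace Literature.ModelTheory.ExponentialFields

namespace Khovanskii

open ExpTerm RealExpModel

variable {m N : ℕ}

/-! ### The transversal level sets are non-degenerate zero sets of the auxiliary systems -/

section Inclusions

variable (G : Fin N → Language.orderedExpRing.Term (Fin m ⊕ Fin (N + 1)))
  (s : Language.orderedExpRing.Term (Fin m ⊕ Fin N)) (β : Fin m → ℝ)

/-- The Jacobian determinant of the contact system at `((β, δ), z)` is `dP(v)(z)`. [folklore] -/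
theorem det_grad_contactSys (δ : ℝ) (z : Fin (N + 2) → ℝ) :
    (Matrix.of fun i => grad (contactSys G s i) (Fin.snoc β δ : Fin (m + 1) → ℝ) z).det =
      fderiv ℝ (fun z : Fin (N + 2) → ℝ => (contactP G s).realize (Sum.elim β z)) z (crossR G β z) := by
  have e : (Matrix.of fun i => grad (contactSys G s i) (Fin.snoc β δ : Fin (m + 1) → ℝ) z) =
      snocRow (jacR G β z) (grad (contactP G s) β z) := by
    ext i j
    simp only [Matrix.of_apply]
    refine Fin.lastCases ?_ (fun r => ?_) i
    · rw [snocRow_last, contactSys, Fin.snoc_last, grad_apply, termPDeriv_add, termPDeriv_neg,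
        ExpTerm.realize_add, ExpTerm.realize_neg, ← grad_apply, ← grad_apply, grad_relabel_kappa,
        grad_pVar]
      simp
    · rw [snocRow_castSucc, contactSys, Fin.snoc_castSucc, grad_relabel_kappa, jacR_apply]
  rw [e, ← dotProduct_cross, fderiv_realize_apply, crossR, dotProduct]
  exact Finset.sum_congr rfl fun j _ => mul_comm _ _

/-- **The transversal level set `{P = δ}` on `Γ_β` consists of non-degenerate zeros of the contact
system at parameters `(β, δ)`.** [cite: Khovanskii1991, Ch. III] -/
theorem levelSet_subset_ndZeros_contactSys (δ : ℝ) :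
    {z | z ∈ (curveData G β).curve ∧ (contactP G s).realize (Sum.elim β z) = δ ∧
        fderiv ℝ (fun z : Fin (N + 2) → ℝ => (contactP G s).realize (Sum.elim β z)) z (crossR G β z) ≠ 0}
      ⊆ ndZeros (contactSys G s) (Fin.snoc β δ) := by
  rintro z ⟨hz, hP, hd⟩
  rw [mem_curve_curveData] at hz
  refine ⟨fun i => ?_, by rw [det_grad_contactSys]; exact hd⟩
  refine Fin.lastCases ?_ (fun r => ?_) i
  · rw [contactSys, Fin.snoc_last, ExpTerm.realize_add, ExpTerm.realize_neg, realize_relabel_kappa,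
      realize_pVar, hP, add_neg_cancel]
  · rw [contactSys, Fin.snoc_castSucc, realize_relabel_kappa]
    exact congrFun hz r

/-- `rho` realizes to `Σ zⱼ²`. [folklore] -/
theorem realize_rho (a : Fin m → ℝ) (z : Fin (N + 2) → ℝ) :
    (rho m N).realize (Sum.elim a z) = ∑ j, z j ^ 2 := by
  rw [rho, ExpTerm.realize_sum]
  refine Finset.sum_congr rfl fun j _ => ?_
  rw [ExpTerm.realize_mul]
  simp [pow_two]

/-- `∇rho = 2 z`. [folklore] -/
theorem grad_rho (a : Fin m → ℝ) (z : Fin (N + 2) → ℝ) (j : Fin (N + 2)) :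
    grad (rho m N) a z j = 2 * z j := by
  classical
  rw [grad_apply, rho, realize_termPDeriv_sum]
  have : ∀ l : Fin (N + 2), (termPDeriv j ((var (Sum.inr l) : Language.orderedExpRing.Term
      (Fin m ⊕ Fin (N + 2))) * var (Sum.inr l))).realize (Sum.elim a z) =
        if l = j then 2 * z j else 0 := by
    intro l
    simp only [termPDeriv_mul, ExpTerm.realize_add, ExpTerm.realize_mul, Term.realize_var,
      Sum.elim_inr]
    simp only [termPDeriv]
    split_ifs with h
    · subst h; simp; ring
    · simp
  simp_rw [this]
  simp

/-- The Jacobian determinant of the sphere system at `((β, R), z)` is `2 Σ zⱼ vⱼ(z)`. [folklore] -/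
theorem det_grad_sphereSys (R : ℝ) (z : Fin (N + 2) → ℝ) :
    (Matrix.of fun i => grad (sphereSys G i) (Fin.snoc β R : Fin (m + 1) → ℝ) z).det =
      2 * ∑ j, z j * crossR G β z j := by
  have e : (Matrix.of fun i => grad (sphereSys G i) (Fin.snoc β R : Fin (m + 1) → ℝ) z) =
      snocRow (jacR G β z) (fun j => 2 * z j) := by
    ext i j
    simp only [Matrix.of_apply]
    refine Fin.lastCases ?_ (fun r => ?_) i
    · rw [snocRow_last, sphereSys, Fin.snoc_last, grad_apply, termPDeriv_add, termPDeriv_neg,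
        ExpTerm.realize_add, ExpTerm.realize_neg, ← grad_apply, ← grad_apply, grad_relabel_kappa,
        grad_pVar, grad_rho]
      simp
    · rw [snocRow_castSucc, sphereSys, Fin.snoc_castSucc, grad_relabel_kappa, jacR_apply]
  rw [e, ← dotProduct_cross, crossR, dotProduct, Finset.mul_sum]
  exact Finset.sum_congr rfl fun j _ => by ring

/-- **The transversal sphere `{Σ zⱼ² = R}` on `Γ_β` consists of non-degenerate zeros of the sphere
system at parameters `(β, R)`.** [cite: Khovanskii1991, Ch. III] -/
theorem sphere_subset_ndZeros_sphereSys (R : ℝ) :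
    {z | z ∈ (curveData G β).curve ∧ ∑ j, z j ^ 2 = R ∧ ∑ j, z j * crossR G β z j ≠ 0}
      ⊆ ndZeros (sphereSys G) (Fin.snoc β R) := by
  rintro z ⟨hz, hR, hd⟩
  rw [mem_curve_curveData] at hz
  refine ⟨fun i => ?_, ?_⟩
  · refine Fin.lastCases ?_ (fun r => ?_) i
    · rw [sphereSys, Fin.snoc_last, ExpTerm.realize_add, ExpTerm.realize_neg, realize_relabel_kappa,
        realize_pVar, realize_rho, hR, add_neg_cancel]
    · rw [sphereSys, Fin.snoc_castSucc, realize_relabel_kappa]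
      exact congrFun hz r
  · rw [det_grad_sphereSys]
    exact mul_ne_zero two_ne_zero hd

end Inclusions

/-! ### The step inequality -/

/-- **Khovanskii's step.** For a square system `F` of `L_exp`-terms, an exponential subterm
`exp(s)` (given as `func exp es`) and real parameters `β`: every finite set `Z₀` of non-degenerate
zeros of `F(β, ·)` satisfies
`2 #Z₀ ≤ 2 #ndZeros(contactSys)(β, δ) + #ndZeros(sphereSys)(β, R)` for some `δ, R`
(the Rolle–Khovanskii count on the regular curve of the lifted stage-1 system, for the function
`g = y e^{-s} - 1` whose transversal zeros include the lifts of `Z₀`, with `dg(v) = e^{-s} P`).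
[cite: Khovanskii1991, Ch. III] [cite: Wilkie1989, §5, Proposition, p. 402] -/
theorem two_mul_card_le_step (F : Fin N → Language.orderedExpRing.Term (Fin m ⊕ Fin N))
    (es : Fin 1 → Language.orderedExpRing.Term (Fin m ⊕ Fin N)) (β : Fin m → ℝ)
    (Z₀ : Finset (Fin N → ℝ)) (hZ₀ : ∀ x ∈ Z₀, x ∈ ndZeros F β) :
    ∃ δ R : ℝ, 2 * (Z₀.card : ℕ∞) ≤
      2 * (ndZeros (contactSys (elimF F (func expRingFunc.exp es)) (es 0)) (Fin.snoc β δ)).encard +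
        (ndZeros (sphereSys (elimF F (func expRingFunc.exp es))) (Fin.snoc β R)).encard := by
  classical
  set G := elimF F (func expRingFunc.exp es) with hG
  set D := curveData G β with hD
  have hκ : ∀ z ∈ D.curve, 0 < Real.exp (-sVal (es 0) β z) := fun z _ => Real.exp_pos _
  have hgP : ∀ z ∈ D.curve, fderiv ℝ (gFun (es 0) β) z (D.v z) =
      Real.exp (-sVal (es 0) β z) * (contactP G (es 0)).realize (Sum.elim β z) :=
    fun z _ => fderiv_gFun_crossR G (es 0) β z
  have hP : ContDiff ℝ 1 (fun z : Fin (N + 2) → ℝ => (contactP G (es 0)).realize (Sum.elim β z)) :=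
    contDiff_realize _ β
  set Z := Z₀.image (liftPt F es β) with hZ
  have hZmem : ∀ z ∈ Z, z ∈ D.curve ∧ gFun (es 0) β z = 0 ∧
      (contactP G (es 0)).realize (Sum.elim β z) ≠ 0 := by
    intro z hz
    rw [hZ, Finset.mem_image] at hz
    obtain ⟨x, hx, rfl⟩ := hz
    exact ⟨(mem_curve_curveData G β).2 (sysFun_liftPt F es β (hZ₀ x hx)), gFun_liftPt F es β x,
      realize_contactP_liftPt_ne_zero F es β (hZ₀ x hx)⟩
  obtain ⟨δ, R, -, -, hcount⟩ := D.two_mul_card_le_of_zeros (differentiable_gFun (es 0) β) hP hκ hgP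
    Z hZmem one_pos 0
  refine ⟨δ, R, ?_⟩
  have hcard : Z.card = Z₀.card := Finset.card_image_of_injective _ (liftPt_injective F es β)
  rw [← hcard]
  refine hcount.trans ?_
  gcongr
  · exact levelSet_subset_ndZeros_contactSys G (es 0) β δ
  · exact sphere_subset_ndZeros_sphereSys G β R

end Khovanskii

end Literature.ModelTheory.ExponentialFields
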